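import Mathlib
import HarnessLib
import Summits.Ventures.LatticeQCDFlow.Exactness.NCMCGeneralSpaceOccupancyChainMixing

/-!
# The mirror minorisation and the Jarzynski sign: the NCMC iteration kernel has a Doeblin square for EVERY `c ≠ ΔF`, and at `c = ΔF` as soon as the work fluctuates

HONEST FRAMING: exact (Metropolis-corrected) sampling algorithms for lattice gauge theory;
figures of merit are autocorrelation/cost numbers at stated couplings and volumes; no
continuum-physics claim.

Venture `LatticeQCDFlow` (cell pub-lqcd), topic `Exactness`; FANOUT row 13 (`eng-snf`, GEN-18).
NEW WORK of the cell, not a published result; no definition is introduced; nothing is cited as a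
fact.  Companion of `NCMCGeneralSpaceOccupancyChainDoeblin.lean` (the two-step minorisation of
`Q = switchKernel κF κR c W s e ∘ₖ levelKernel T₀ T₁` with PRIOR-level regeneration, constant `≠ 0`
iff the forward switch is rejected with positive `m₀`-mass) and `…Mixing` (its reading).  Here: the
TARGET-level (mirror) regeneration in skeleton form, and WHEN one of the two applies.  The point:
Crooks' identity at total mass is Jarzynski's `∫ e^{−W} d(ν₀ ∘ κF) = Z₁`, so the forward work cannot
stay below `c` when `c < ΔF`, and the reverse work cannot stay above `c` when `c > ΔF` — for every
`c ≠ ΔF` one of the two rejection masses is positive WITHOUT ANY HYPOTHESIS ON THE PROTOCOL; at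
`c = ΔF` it suffices that the work is not almost surely equal to `ΔF` (a protocol with non-zero
dissipation).

## Content

* §1 mirror reading: `revFlow_univ_eq_one_iff` (`R_c(y, Ω) = 1 ⇔` `κR y`-a.s. `c ≤ W`),
  `lintegral_rejT_eq_zero_iff`, **`lintegral_rejT_ne_zero_of_bind`** (`ν₁ ≪ m₁` and the reverse
  work undershoots `c` with positive `ν₁ ∘ κR`-mass ⇒ `ρ₁ ≠ 0`).
* §2 mirror skeleton: `rejTarget_univ`, `isProbabilityMeasure_rejTarget_normalised`,
  **`ncmc_nHit_two_doeblin_target`** (`ε' • ν' ≤ nHit Q 2 z`, `ε' = min(ρ₁, α₀) ρ₁`,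
  `ν' = ρ₁⁻¹ ((1 − R_c) m₁ ⊗ δ_target)`), `ncmc_sq_doeblin_target_const_ne_zero`.
* §3 THE JARZYNSKI SIGN (Crooks pairs between finite non-zero weights, `e^{−ΔF} = Z₁/Z₀`; GEN-12's
  `CrooksPair.lintegral_exp_neg_work` / `…_exp_work_rev`, `∫ e^{∓W} = Z₁`, `Z₀`):
  **`CrooksPair.bind_work_gt_ne_zero_of_lt`** (`c < ΔF ⇒ (ν₀ ∘ κF){W > c} ≠ 0`),
  **`CrooksPair.bind_work_lt_ne_zero_of_gt`** (`ΔF < c ⇒ (ν₁ ∘ κR){W < c} ≠ 0`),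
  `CrooksPair.bind_absolutelyContinuous_bind` (`ν₀ ∘ κF ≪ ν₁ ∘ κR`, density `e^{−W} > 0`),
  **`CrooksPair.work_ne_dichotomy`** (`(ν₀ ∘ κF){W ≠ c} ≠ 0 ⇒` forward work `> c` with positive
  `ν₀ ∘ κF`-mass OR reverse work `< c` with positive `ν₁ ∘ κR`-mass),
  **`CrooksPair.bind_work_ne_ne_zero_of_ne`** (`c ≠ ΔF ⇒ (ν₀ ∘ κF){W ≠ c} ≠ 0`).
* §4 **`CrooksPair.ncmc_exists_sq_doeblin`** — THE COMBINED CERTIFICATE: level samplers minorised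
  by finite non-zero `m₀`, `m₁` with `ν₀ ≪ m₀`, `ν₁ ≪ m₁` (the heat-bath shape), and the forward work
  NOT almost surely equal to `c` ⇒ `∃ ε ≠ 0, ∃ ν` probability law, `ε • ν ≤ nHit Q 2 z` for all `z`;
  **`CrooksPair.ncmc_exists_sq_doeblin_of_ne`** — the same for every `c ≠ ΔF`, no work hypothesis.

NOT CLAIMED: `c = ΔF` with `W ≡ ΔF` (perfect protocol: period-two chain, no Doeblin power).
-/

namespace Summit.Ventures.LatticeQCDFlow.Exactness.GeneralNCMC

open MeasureTheory ProbabilityTheory Set Filter Finset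
open scoped ENNReal Topology

variable {Ω E : Type*} [MeasurableSpace Ω] [MeasurableSpace E]

/-! ## §1 Mirror reading -/

section MirrorReading

variable (κR : Kernel Ω E) [IsMarkovKernel κR] (c : ℝ) {W : E → ℝ} (s : E → Ω)

/-- **The reverse switch from `y` is almost surely accepted iff the reverse work from `y` never
undershoots `c`**: `R_c(y, Ω) = 1 ⇔` `κR y`-a.s. `c ≤ W`. -/
theorem revFlow_univ_eq_one_iff (hW : Measurable W) (y : Ω) :
    revFlow κR c W s y univ = 1 ↔ ∀ᵐ ε ∂(κR y), c ≤ W ε := by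
  have hacc := measurable_accR c hW
  have hfin : ∫⁻ ε, accR c W ε ∂(κR y) ≠ ∞ := by
    refine ne_top_of_le_ne_top ENNReal.one_ne_top ?_
    calc ∫⁻ ε, accR c W ε ∂(κR y) ≤ ∫⁻ _, 1 ∂(κR y) := lintegral_mono fun ε => accR_le_one c W ε
      _ = 1 := by rw [lintegral_const, measure_univ, mul_one]
  have hsub : ∫⁻ ε, (1 - accR c W ε) ∂(κR y) = 1 - revFlow κR c W s y univ := by
    rw [revFlow_univ, lintegral_sub hacc hfin (Eventually.of_forall fun ε => accR_le_one c W ε),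
      lintegral_const, measure_univ, mul_one]
  have hpt : ∀ ε, accR c W ε = 1 ↔ c ≤ W ε := fun ε => by
    unfold accR
    rw [← ENNReal.ofReal_one, ENNReal.ofReal_eq_ofReal_iff (le_min zero_le_one (Real.exp_pos _).le)
      zero_le_one, min_eq_left_iff, Real.one_le_exp_iff, sub_nonneg]
  have hm1 : Measurable fun ε => 1 - accR c W ε := measurable_const.sub hacc
  constructor
  · intro h1
    have h0 : ∫⁻ ε, (1 - accR c W ε) ∂(κR y) = 0 := by rw [hsub, h1, tsub_self]
    rw [lintegral_eq_zero_iff hm1] at h0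
    filter_upwards [h0] with ε hε
    exact (hpt ε).1 (le_antisymm (accR_le_one c W ε) (tsub_eq_zero_iff_le.1 hε))
  · intro hae
    rw [revFlow_univ]
    calc ∫⁻ ε, accR c W ε ∂(κR y) = ∫⁻ _, 1 ∂(κR y) :=
          lintegral_congr_ae (hae.mono fun ε hε => (hpt ε).2 hε)
      _ = 1 := by rw [lintegral_const, measure_univ, mul_one]

/-- `ρ₁ = ∫ (1 − R_c(y', Ω)) dm₁ = 0 ⇔` for `m₁`-a.e. `y'`, `κR y'`-a.s. `c ≤ W`. -/
theorem lintegral_rejT_eq_zero_iff (hW : Measurable W) (hs : Measurable s) (m₁ : Measure Ω) :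
    ∫⁻ y', (1 - revFlow κR c W s y' univ) ∂m₁ = 0 ↔ ∀ᵐ y' ∂m₁, ∀ᵐ ε ∂(κR y'), c ≤ W ε := by
  have hm : Measurable fun y' => 1 - revFlow κR c W s y' univ :=
    measurable_const.sub (measurable_revFlow κR c hW hs MeasurableSet.univ)
  rw [lintegral_eq_zero_iff hm]
  refine ⟨fun h => h.mono fun y' hy => ?_, fun h => h.mono fun y' hy => ?_⟩
  · exact (revFlow_univ_eq_one_iff κR c s hW y').1
      (le_antisymm (revFlow_le_one κR c W s y' univ) (tsub_eq_zero_iff_le.1 hy))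
  · change 1 - revFlow κR c W s y' univ = 0
    rw [(revFlow_univ_eq_one_iff κR c s hW y').2 hy, tsub_self]

/-- **Mirror heat-bath reading**: `ν₁ ≪ m₁` and the reverse work undershoots `c` with positive
`ν₁ ∘ κR`-mass ⇒ `ρ₁ ≠ 0`. -/
theorem lintegral_rejT_ne_zero_of_bind (hW : Measurable W) (hs : Measurable s) {ν₁ m₁ : Measure Ω}
    (hac : ν₁ ≪ m₁) (hlt : (ν₁.bind κR) {ε | W ε < c} ≠ 0) :
    ∫⁻ y', (1 - revFlow κR c W s y' univ) ∂m₁ ≠ 0 := by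
  intro h0
  have hset : MeasurableSet {ε | W ε < c} := measurableSet_lt hW measurable_const
  have hae : ∀ᵐ y' ∂ν₁, κR y' {ε | W ε < c} = 0 := by
    filter_upwards [hac.ae_le ((lintegral_rejT_eq_zero_iff κR c s hW hs m₁).1 h0)] with y' hy
    rw [measure_eq_zero_iff_ae_notMem]
    filter_upwards [hy] with ε hε
    exact not_lt.2 hε
  apply hlt
  rw [Measure.bind_apply hset (Kernel.aemeasurable _), lintegral_congr_ae hae, lintegral_zero]

end MirrorReading

/-! ## §2 Mirror skeleton -/

section MirrorSkeleton

variable {κF κR : Kernel Ω E} [IsMarkovKernel κF] [IsMarkovKernel κR] {c : ℝ} {W : E → ℝ}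
  {s e : E → Ω} {T₀ T₁ : Kernel Ω Ω} {m₀ m₁ : Measure Ω}

omit [IsMarkovKernel κR] in
/-- The tagged rejected reverse mass has total mass `ρ₁ = ∫ (1 − R_c(y', Ω)) dm₁`. -/
theorem rejTarget_univ (m₁ : Measure Ω) :
    (m₁.withDensity fun y' => 1 - revFlow κR c W s y' univ).map (Prod.mk true) univ =
      ∫⁻ y', (1 - revFlow κR c W s y' univ) ∂m₁ := by
  rw [Measure.map_apply measurable_prodMk_left MeasurableSet.univ, preimage_univ,
    withDensity_apply _ MeasurableSet.univ, Measure.restrict_univ]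

omit [IsMarkovKernel κR] in
/-- `ρ₁ ≤ m₁(Ω)`. -/
theorem lintegral_rejT_le (m₁ : Measure Ω) :
    ∫⁻ y', (1 - revFlow κR c W s y' univ) ∂m₁ ≤ m₁ univ := by
  calc ∫⁻ y', (1 - revFlow κR c W s y' univ) ∂m₁ ≤ ∫⁻ _, 1 ∂m₁ :=
        lintegral_mono fun y' => tsub_le_self
    _ = m₁ univ := by rw [lintegral_const, one_mul]

omit [IsMarkovKernel κR] in
/-- Normalising the tagged rejected reverse mass by `ρ₁` gives a probability law. -/
theorem isProbabilityMeasure_rejTarget_normalised [IsFiniteMeasure m₁]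
    (hρ : ∫⁻ y', (1 - revFlow κR c W s y' univ) ∂m₁ ≠ 0) :
    IsProbabilityMeasure ((∫⁻ y', (1 - revFlow κR c W s y' univ) ∂m₁)⁻¹ •
      (m₁.withDensity fun y' => 1 - revFlow κR c W s y' univ).map (Prod.mk true)) := by
  refine ⟨?_⟩
  rw [Measure.smul_apply, smul_eq_mul, rejTarget_univ]
  exact ENNReal.inv_mul_cancel hρ
    (ne_top_of_le_ne_top (measure_ne_top m₁ univ) (lintegral_rejT_le m₁))

/-- **Mirror skeleton form**: `ε' • ν' ≤ (nHit Q 2)(z, ·)` for every `z`, `ε' = min(ρ₁, α₀) ρ₁`,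
`ν' = ρ₁⁻¹ ((1 − R_c(·, Ω)) m₁ ⊗ δ_target)`. -/
theorem ncmc_nHit_two_doeblin_target (hW : Measurable W) (hs : Measurable s) (he : Measurable e)
    [IsFiniteMeasure m₁] (hmin₀ : ∀ x, m₀ ≤ T₀ x) (hmin₁ : ∀ y, m₁ ≤ T₁ y)
    (hρ : ∫⁻ y', (1 - revFlow κR c W s y' univ) ∂m₁ ≠ 0) (z : Bool × Ω) :
    (min (∫⁻ y', (1 - revFlow κR c W s y' univ) ∂m₁) (∫⁻ x', fwdFlow κF c W e x' univ ∂m₀) *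
        ∫⁻ y', (1 - revFlow κR c W s y' univ) ∂m₁) •
      ((∫⁻ y', (1 - revFlow κR c W s y' univ) ∂m₁)⁻¹ •
        (m₁.withDensity fun y' => 1 - revFlow κR c W s y' univ).map (Prod.mk true)) ≤
      nHit (switchKernel κF κR c W s e ∘ₖ levelKernel T₀ T₁) 2 z := by
  have hρtop : ∫⁻ y', (1 - revFlow κR c W s y' univ) ∂m₁ ≠ ∞ :=
    ne_top_of_le_ne_top (measure_ne_top m₁ univ) (lintegral_rejT_le m₁)
  rw [nHit_two, smul_smul, mul_assoc, ENNReal.mul_inv_cancel hρ hρtop, mul_one]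
  exact ncmc_sq_minorised_target T₀ T₁ hW hs he hmin₀ hmin₁ z

omit [IsMarkovKernel κR] in
/-- The mirror constant `ε' = min(ρ₁, α₀) ρ₁` is non-zero iff `ρ₁ ≠ 0` (given `m₀ ≠ 0`). -/
theorem ncmc_sq_doeblin_target_const_ne_zero (hW : Measurable W) (he : Measurable e)
    (hm₀ : m₀ univ ≠ 0) (hρ : ∫⁻ y', (1 - revFlow κR c W s y' univ) ∂m₁ ≠ 0) :
    min (∫⁻ y', (1 - revFlow κR c W s y' univ) ∂m₁) (∫⁻ x', fwdFlow κF c W e x' univ ∂m₀) *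
      ∫⁻ y', (1 - revFlow κR c W s y' univ) ∂m₁ ≠ 0 :=
  mul_ne_zero (fun h => by
    rcases min_eq_iff.1 h with ⟨h1, -⟩ | ⟨h1, -⟩
    · exact hρ h1
    · exact lintegral_fwdFlow_univ_ne_zero hW he hm₀ h1) hρ

end MirrorSkeleton

/-! ## §3 The Jarzynski sign -/

namespace CrooksPair

variable {ν₀ ν₁ : Measure Ω} {κF κR : Kernel Ω E} [IsMarkovKernel κF] [IsMarkovKernel κR]
  {s e : E → Ω} {W : E → ℝ}

omit [IsMarkovKernel κF] in
/-- **`c < ΔF` ⇒ the forward work exceeds `c` with positive `ν₀ ∘ κF`-mass** (else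
`Z₁ = ∫ e^{−W} ≥ e^{−c} Z₀`, i.e. `ΔF ≤ c`). -/
theorem bind_work_gt_ne_zero_of_lt [IsFiniteMeasure ν₀] [IsFiniteMeasure ν₁]
    (h : CrooksPair ν₀ ν₁ κF κR s e W) (h0 : ν₀ univ ≠ 0) {c ΔF : ℝ}
    (hΔF : Real.exp (-ΔF) = ((ν₀ univ)⁻¹ * ν₁ univ).toReal) (hc : c < ΔF) [IsMarkovKernel κF] :
    (ν₀.bind κF) {ε | c < W ε} ≠ 0 := by
  intro hzero
  -- `e^{−W} ≥ e^{−c}` almost everywhere under `ν₀ ∘ κF`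
  have hae : ∀ᵐ ε ∂(ν₀.bind κF), ENNReal.ofReal (Real.exp (-c)) ≤ ENNReal.ofReal (Real.exp (-W ε)) := by
    have : ∀ᵐ ε ∂(ν₀.bind κF), ε ∉ {ε | c < W ε} := measure_eq_zero_iff_ae_notMem.1 hzero
    filter_upwards [this] with ε hε
    exact ENNReal.ofReal_le_ofReal (Real.exp_le_exp.2 (neg_le_neg (not_lt.1 hε)))
  have hle : ENNReal.ofReal (Real.exp (-c)) * ν₀ univ ≤ ν₁ univ := by
    calc ENNReal.ofReal (Real.exp (-c)) * ν₀ univ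
        = ∫⁻ _, ENNReal.ofReal (Real.exp (-c)) ∂(ν₀.bind κF) := by
          rw [lintegral_const, bind_apply_univ_of_markov κF ν₀]
      _ ≤ ∫⁻ ε, ENNReal.ofReal (Real.exp (-W ε)) ∂(ν₀.bind κF) := lintegral_mono_ae hae
      _ = ν₁ univ := h.lintegral_exp_neg_work
  -- hence `e^{−c} ≤ Z₁/Z₀ = e^{−ΔF}`, contradicting `c < ΔF`
  have hratio : ENNReal.ofReal (Real.exp (-c)) ≤ (ν₀ univ)⁻¹ * ν₁ univ := by
    rw [mul_comm, ← div_eq_mul_inv]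
    exact (ENNReal.le_div_iff_mul_le (Or.inl h0) (Or.inl (measure_ne_top ν₀ univ))).2 hle
  have hreal : Real.exp (-c) ≤ Real.exp (-ΔF) := by
    have := ENNReal.toReal_mono
      (ENNReal.mul_ne_top (ENNReal.inv_ne_top.2 h0) (measure_ne_top ν₁ univ)) hratio
    rwa [ENNReal.toReal_ofReal (Real.exp_pos _).le, ← hΔF] at this
  exact absurd (Real.exp_le_exp.1 hreal) (not_le.2 (neg_lt_neg hc))

omit [IsMarkovKernel κR] in
/-- **`ΔF < c` ⇒ the reverse work undershoots `c` with positive `ν₁ ∘ κR`-mass** (else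
`Z₀ = ∫ e^{W} d(ν₁ ∘ κR) ≥ e^{c} Z₁`, i.e. `c ≤ ΔF`). -/
theorem bind_work_lt_ne_zero_of_gt [IsFiniteMeasure ν₀] [IsFiniteMeasure ν₁]
    (h : CrooksPair ν₀ ν₁ κF κR s e W) (h0 : ν₀ univ ≠ 0) {c ΔF : ℝ}
    (hΔF : Real.exp (-ΔF) = ((ν₀ univ)⁻¹ * ν₁ univ).toReal) (hc : ΔF < c) [IsMarkovKernel κR] :
    (ν₁.bind κR) {ε | W ε < c} ≠ 0 := by
  intro hzero
  have hae : ∀ᵐ ε ∂(ν₁.bind κR), ENNReal.ofReal (Real.exp c) ≤ ENNReal.ofReal (Real.exp (W ε)) := by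
    have : ∀ᵐ ε ∂(ν₁.bind κR), ε ∉ {ε | W ε < c} := measure_eq_zero_iff_ae_notMem.1 hzero
    filter_upwards [this] with ε hε
    exact ENNReal.ofReal_le_ofReal (Real.exp_le_exp.2 (not_lt.1 hε))
  have hle : ENNReal.ofReal (Real.exp c) * ν₁ univ ≤ ν₀ univ := by
    calc ENNReal.ofReal (Real.exp c) * ν₁ univ
        = ∫⁻ _, ENNReal.ofReal (Real.exp c) ∂(ν₁.bind κR) := by
          rw [lintegral_const, bind_apply_univ_of_markov κR ν₁]
      _ ≤ ∫⁻ ε, ENNReal.ofReal (Real.exp (W ε)) ∂(ν₁.bind κR) := lintegral_mono_ae hae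
      _ = ν₀ univ := h.lintegral_exp_work_rev
  -- in real numbers: `e^{c} Z₁ ≤ Z₀`, so `e^{−ΔF} = Z₁/Z₀ ≤ e^{−c}`
  have hZ₀ : 0 < (ν₀ univ).toReal := ENNReal.toReal_pos h0 (measure_ne_top _ _)
  have hrealle : Real.exp c * (ν₁ univ).toReal ≤ (ν₀ univ).toReal := by
    have := ENNReal.toReal_mono (measure_ne_top ν₀ univ) hle
    rwa [ENNReal.toReal_mul, ENNReal.toReal_ofReal (Real.exp_pos _).le] at this
  have hreal : Real.exp (-ΔF) ≤ Real.exp (-c) := by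
    rw [hΔF, ENNReal.toReal_mul, ENNReal.toReal_inv, inv_mul_le_iff₀ hZ₀, Real.exp_neg,
      ← div_eq_mul_inv, le_div_iff₀ (Real.exp_pos c), mul_comm]
    exact hrealle
  exact absurd (Real.exp_le_exp.1 hreal) (not_le.2 (neg_lt_neg hc))

omit [IsMarkovKernel κF] [IsMarkovKernel κR] in
/-- The two un-normalised record laws of a Crooks pair are mutually absolutely continuous: here
`ν₀ ∘ κF ≪ ν₁ ∘ κR` (density `e^{−W} > 0`). -/
theorem bind_absolutelyContinuous_bind (h : CrooksPair ν₀ ν₁ κF κR s e W) :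
    ν₀.bind κF ≪ ν₁.bind κR := by
  rw [← h.crooks]
  exact withDensity_absolutelyContinuous'
    ((Real.measurable_exp.comp h.measurable_W.neg).ennreal_ofReal).aemeasurable
    (Eventually.of_forall fun ε => (ENNReal.ofReal_pos.2 (Real.exp_pos _)).ne')

omit [IsMarkovKernel κF] [IsMarkovKernel κR] in
/-- … and `ν₁ ∘ κR ≪ ν₀ ∘ κF`. -/
theorem bindRev_absolutelyContinuous_bind (h : CrooksPair ν₀ ν₁ κF κR s e W) :
    ν₁.bind κR ≪ ν₀.bind κF := by
  rw [← h.crooks]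
  exact withDensity_absolutelyContinuous _ _

omit [IsMarkovKernel κF] [IsMarkovKernel κR] in
/-- **Dichotomy**: if the forward work is not almost surely equal to `c`, then either it exceeds `c`
with positive `ν₀ ∘ κF`-mass, or the reverse work undershoots `c` with positive `ν₁ ∘ κR`-mass. -/
theorem work_ne_dichotomy (h : CrooksPair ν₀ ν₁ κF κR s e W) {c : ℝ}
    (hne : (ν₀.bind κF) {ε | W ε ≠ c} ≠ 0) :
    (ν₀.bind κF) {ε | c < W ε} ≠ 0 ∨ (ν₁.bind κR) {ε | W ε < c} ≠ 0 := by
  by_cases hgt : (ν₀.bind κF) {ε | c < W ε} = 0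
  · right
    intro hlt
    have hlt' : (ν₀.bind κF) {ε | W ε < c} = 0 := h.bind_absolutelyContinuous_bind hlt
    apply hne
    have hsub : {ε | W ε ≠ c} ⊆ {ε | c < W ε} ∪ {ε | W ε < c} := fun ε hε => by
      rcases lt_or_gt_of_ne hε with h1 | h1
      · exact Or.inr h1
      · exact Or.inl h1
    exact measure_mono_null hsub (measure_union_null hgt hlt')
  · exact Or.inl hgt

omit [IsMarkovKernel κF] in
/-- **For `c ≠ ΔF` the forward work is never almost surely equal to `c`.** -/
theorem bind_work_ne_ne_zero_of_ne [IsFiniteMeasure ν₀] [IsFiniteMeasure ν₁]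
    (h : CrooksPair ν₀ ν₁ κF κR s e W) (h0 : ν₀ univ ≠ 0) {c ΔF : ℝ}
    (hΔF : Real.exp (-ΔF) = ((ν₀ univ)⁻¹ * ν₁ univ).toReal) (hc : c ≠ ΔF) [IsMarkovKernel κF] :
    (ν₀.bind κF) {ε | W ε ≠ c} ≠ 0 := by
  rcases lt_or_gt_of_ne hc with hlt | hgt
  · intro hz
    exact h.bind_work_gt_ne_zero_of_lt h0 hΔF hlt
      (measure_mono_null (fun ε (hε : c < W ε) => ne_of_gt hε) hz)
  · intro hz
    have hz' : (ν₀.bind κF) {ε | W ε < c} = 0 :=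
      measure_mono_null (fun ε (hε : W ε < c) => ne_of_lt hε) hz
    exact h.bind_work_lt_ne_zero_of_gt h0 hΔF hgt (h.bindRev_absolutelyContinuous_bind hz')

/-! ## §4 The combined certificate -/

/-- **THE COMBINED TWO-STEP DOEBLIN CERTIFICATE.**  Crooks pair; level samplers dominating finite
non-zero measures `m₀`, `m₁` from every configuration with `ν₀ ≪ m₀`, `ν₁ ≪ m₁` (e.g. all four have
positive densities against one reference — the heat-bath shape); the forward work NOT almost surely
equal to `c`.  Then some power-two Doeblin minorisation `ε • ν ≤ (nHit Q 2)(z, ·)` (`ε ≠ 0`, `ν` a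
probability law) holds from every `z` — by prior-level or by target-level regeneration. -/
theorem ncmc_exists_sq_doeblin (h : CrooksPair ν₀ ν₁ κF κR s e W) {T₀ T₁ : Kernel Ω Ω}
    {m₀ m₁ : Measure Ω} [IsFiniteMeasure m₀] [IsFiniteMeasure m₁] (hm₀ : m₀ univ ≠ 0)
    (hm₁ : m₁ univ ≠ 0) (hmin₀ : ∀ x, m₀ ≤ T₀ x) (hmin₁ : ∀ y, m₁ ≤ T₁ y) (hac₀ : ν₀ ≪ m₀)
    (hac₁ : ν₁ ≪ m₁) (c : ℝ) (hW : (ν₀.bind κF) {ε | W ε ≠ c} ≠ 0) :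
    ∃ (ε : ℝ≥0∞) (ν : Measure (Bool × Ω)), IsProbabilityMeasure ν ∧ ε ≠ 0 ∧
      ∀ z, ε • ν ≤ nHit (switchKernel κF κR c W s e ∘ₖ levelKernel T₀ T₁) 2 z := by
  rcases h.work_ne_dichotomy hW with hgt | hlt
  · have hρ := lintegral_rej_ne_zero_of_bind κF c e h.measurable_W h.measurable_e hac₀ hgt
    exact ⟨_, _, isProbabilityMeasure_rejPrior_normalised hρ,
      ncmc_sq_doeblin_const_ne_zero h.measurable_W h.measurable_s hm₁ hρ,
      ncmc_nHit_two_doeblin h.measurable_W h.measurable_s h.measurable_e hmin₀ hmin₁ hρ⟩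
  · have hρ := lintegral_rejT_ne_zero_of_bind κR c s h.measurable_W h.measurable_s hac₁ hlt
    exact ⟨_, _, isProbabilityMeasure_rejTarget_normalised hρ,
      ncmc_sq_doeblin_target_const_ne_zero h.measurable_W h.measurable_e hm₀ hρ,
      ncmc_nHit_two_doeblin_target h.measurable_W h.measurable_s h.measurable_e hmin₀ hmin₁ hρ⟩

/-- **… and for every `c ≠ ΔF`, with no hypothesis on the protocol at all.** -/
theorem ncmc_exists_sq_doeblin_of_ne [IsFiniteMeasure ν₀] [IsFiniteMeasure ν₁]
    (h : CrooksPair ν₀ ν₁ κF κR s e W) (h0 : ν₀ univ ≠ 0) {T₀ T₁ : Kernel Ω Ω}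
    {m₀ m₁ : Measure Ω} [IsFiniteMeasure m₀] [IsFiniteMeasure m₁] (hm₀ : m₀ univ ≠ 0)
    (hm₁ : m₁ univ ≠ 0) (hmin₀ : ∀ x, m₀ ≤ T₀ x) (hmin₁ : ∀ y, m₁ ≤ T₁ y) (hac₀ : ν₀ ≪ m₀)
    (hac₁ : ν₁ ≪ m₁) {c ΔF : ℝ} (hΔF : Real.exp (-ΔF) = ((ν₀ univ)⁻¹ * ν₁ univ).toReal)
    (hc : c ≠ ΔF) :
    ∃ (ε : ℝ≥0∞) (ν : Measure (Bool × Ω)), IsProbabilityMeasure ν ∧ ε ≠ 0 ∧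
      ∀ z, ε • ν ≤ nHit (switchKernel κF κR c W s e ∘ₖ levelKernel T₀ T₁) 2 z :=
  h.ncmc_exists_sq_doeblin hm₀ hm₁ hmin₀ hmin₁ hac₀ hac₁ c (h.bind_work_ne_ne_zero_of_ne h0 hΔF hc)

end CrooksPair

end Summit.Ventures.LatticeQCDFlow.Exactness.GeneralNCMC
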